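import Summits.HodgeConjecture.CorCM.HypDel.ExtAmbientReceptacleLevelForm
import Summits.HodgeConjecture.HodgeConjecture.Theorems.HDelOfHodgeTypeExt
import HarnessLib

/-!
# τ0-T3 (4/4) — S3 second layer, second half (`LeafT1`, transition/translation descent, `closureDescent_of_leaves`), S3 IS A THEOREM (`closureDescent_holds`), the head `canonicalModel_exists_ext_of`, the §5 audit, and `HDel_of_receptacle`

Cell `hodgecm-mathlib`, crux `HDel` (stmt-HodgeConjecture-24835), fan B / B-plan2 (T3 pen), KEY `t3-tau0-ext-receptacle-port` (B-p19 g5).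
τ0-T3 RELOCATES, VERBATIM, the vocabulary and the kernel-checked reductions of the planning workfile
`Summits/HodgeConjecture/HodgeConjecture/Cruxes/HDel/Lines/F1ExtHodgeType.lean` v3b (sha16 2a4912bcb51bc6f9; B-plan2 g2–g4) into IMPORTABLE
Summits modules (namespace `Summit.HodgeConjecture.CorCM.HypDel.ExtReceptacle`; split in four files by the gate's 400-line rule, workfile order kept:
`ExtAmbientReceptacle` §1–§2 · `ExtAmbientReceptacleImageStable` §3 · `ExtAmbientReceptacleLevelForm` §3b first half ·
`ExtAmbientReceptacleHDel` §3b second half + head + §5 + §7), so that v4's stubs, their leaf closers and the final by-name `HDel` closer can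
`import` these names (a Cruxes workfile is not importable by Theorems files — the τ0 / T4 lesson, ★ p633409).  Statements, binders and proofs
are byte-identical to v3b; relocation edits only (the workfile's one open stub, its consumer and the skeleton head are NOT carried; the six
closed `stub_*` theorems are renamed `*_holds`; the v2 census §6 is dropped).  NOTHING NEW IS ASSERTED; 0 `sorry`.
STATEMENT CONVENTIONS (unchanged): every binder block is the binder block of `Aux.canonicalModel_exists_ext_printed` VERBATIM (B-typ04 ★ p608274),
and `ReciprocityThrough` is the body of `Aux.IsCanonicalDescentAtExt` VERBATIM with the form `(N.obj K, e.inv.app K)` replaced by a receptacle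
`(A, ι)`; no new Literature notion, no instance, no notation.

THIS FILE (4/4): §3b second half (workfile :629–:799) — `LeafT1`, `leafT1_holds` (★ p627060), `levelForm_instances`, `transitionDescends_of_leaves`,
`translationDescends_of_leaves` (T2 ★ p626711, G2, ASM ★ p627312), `closureDescent_of_leaves`; §4 `closureDescent_holds` + head `canonicalModel_exists_ext_of`;
§5 audit `example`; §7 `HDel_of_receptacle : AmbientReceptacleExists → …Theses.HCCMUnconditional.HDel` (axioms trio).  The only file of the four that
imports a Theses-cone module (`…Theorems.HDelOfHodgeTypeExt`, for `HypDel.HDel_of_ext'`).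
HC_CM is proved only modulo the 7 printed citations until rung 0 closes; nothing in this file is a proof of I-1′ or of `HDel`.
[cite: Deligne1971TravauxShimura, Cor. 5.7 p. 156, Exemple 5.8 and Variante 5.9 p. 157, Prop. 1.15 p. 132, 5.2 p. 155, Thm. 4.21 p. 152]
[cite: Deligne1979ShimuraVarieties, Criterion 2.3.1 and 2.2.5 (PDF p. 29), Prop. 2.3.10 (PDF p. 32) of Milne's translation]
[cite: MumfordFogartyKirwan1994, Ch. 7 §3 Thm. 7.9] [cite: Shimura1998, §18.6 Thm. 18.6] [cite: Milne2005ShimuraVarieties, Def. 12.8 (62) p. 114, §13 p. 117, §14 pp. 126–127]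
-/

open Function MulAction Topology NumberField IsDedekindDomain CategoryTheory CategoryTheory.Limits Matrix
  AlgebraicGeometry
open scoped Matrix ComplexOrder
open Literature.AlgebraicGeometry Literature.AlgebraicGeometry.Motives
open Literature.NumberTheory.Automorphic Literature.NumberTheory.Automorphic.UnitaryGroup
open Literature.NumberTheory.Automorphic.Liu2021.AppendixC (C5.OpenCompactSubgroup C5.SmallLevel)
open Literature.Geometry.ComplexHyperbolic Literature.Geometry.ComplexHyperbolic.BallModel
open Literature.NumberTheory.Automorphic.ShimuraDissection
open Literature.AlgebraicGeometry.ShimuraVarieties Literature.AlgebraicGeometry.ShimuraVarieties.UnitaryCanonicalModel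
open Literature.AlgebraicGeometry.ShimuraVarieties.UnitaryCanonicalModel.Aux
open Literature.NumberTheory.ComplexMultiplication (traceField reflexNormFiniteIdele)
open Literature.NumberTheory.AdelicBaseChange (finiteIdeleRelNorm)

namespace Summit.HodgeConjecture.CorCM.HypDel.ExtReceptacle

section S3SecondLayer

/-- **LEAF (T1) — [Milne 2005] Prop. 13.1 IN DENSE FORM: a `ℂ`-morphism between base changes of `K`-schemes that commutes with `Aut(ℂ/K)` on
a DENSE set of complex points descends (uniquely) to `K`** (`K ⊆ ℂ` countable, source reduced and lft after base change, target separated).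
Road: ★ `GaloisDescent.existsUnique_map_eq_complex` + its equivariance hypothesis from the dense set by ★ `Morphisms.ext_of_dense_of_forall_exists_comp_eq`
(test morphisms `P.left`, ★ `dense_image_pt_of_dense`, ★ `AlgPoints.baseChangeEquiv_left_comp_gal`).  WRITER: A-p13 g9 (cell STATUS 10:49:24Z,
`Motives/ComplexAutGaloisDescentOfDense.lean` :: `GaloisDescent.existsUnique_map_eq_of_dense_complex`) — this signature; the stub below closes by name
on landing.  [cite: Milne2005ShimuraVarieties, Prop. 13.1 p. 117, Thm. 13.7 (b) p. 120] -/
def LeafT1 : Prop :=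
  ∀ (K : Type) [Field K] [Algebra K ℂ], Cardinal.mk K ≤ Cardinal.aleph0 →
    ∀ (X Y : SchemeOver K) [IsReduced ((Motives.baseChange K ℂ).obj X).left] [IsSeparated Y.hom]
      [LocallyOfFiniteType ((Motives.baseChange K ℂ).obj X).hom]
      (g : (Motives.baseChange K ℂ).obj X ⟶ (Motives.baseChange K ℂ).obj Y)
      (T : Set (ComplexPoints ((Motives.baseChange K ℂ).obj X))), Dense T →
      (∀ σ : ℂ ≃ₐ[K] ℂ, ∀ P ∈ T,
        AlgPoints.map g (AlgPoints.baseChangeEquiv (algebraMap K ℂ) X (σ • (AlgPoints.baseChangeEquiv (algebraMap K ℂ) X).symm P)) =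
          AlgPoints.baseChangeEquiv (algebraMap K ℂ) Y (σ • (AlgPoints.baseChangeEquiv (algebraMap K ℂ) Y).symm (AlgPoints.map g P))) →
      ∃! f : X ⟶ Y, (Motives.baseChange K ℂ).map f = g

/-- **(T1) closed BY NAME** — ★ p627060 `GaloisDescent.existsUnique_map_eq_of_dense_complex` (A-p13 g9, `Motives/ComplexAutGaloisDescentOfDense`,
landed 11:01:47Z; the statement above token for token, `Motives.baseChange K ℂ = bcFunctor K ℂ` and `bc ℂ X = ((bcFunctor K ℂ).obj X).left` by `rfl`). -/
theorem leafT1_holds : LeafT1 := by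
  intro K _ _ hK X Y hred _ hlft g T hT h
  haveI : IsReduced (GaloisDescent.bc ℂ X) := hred
  haveI : LocallyOfFiniteType ((AbelianVariety.bcFunctor K ℂ).obj X).hom := hlft
  exact GaloisDescent.existsUnique_map_eq_of_dense_complex hK g hT h

/-- The instances and the dense special set that feed (T1) at a level form: `N ⊗_E ℂ ≅ ∐ Sc.Mc_K` is reduced and lft (smooth), and every
level form is separated over `E` (projectivity of `∐ Sc.Mc_K` — finitely many projective summands, ★ `Aux.finite_classGroup_printed_holds` —
descends along `ℂ/E`, ★ `IsProjectiveOver.baseChange_iff`). [cite: GortzWedhorn2020, Prop. 14.57 p. 571] [cite: Hartshorne1977, II Thm. 4.9 p. 103] -/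
theorem levelForm_instances {L : Type} [Field L] [NumberField L] [IsCMField L] {H : Matrix (Fin 3) (Fin 3) L} {τ : L →+* ℂ}
    {T : GL (Fin 3) ℂ} {hT : formCongr (starRingEnd ℂ) T (H.map τ) = BallModel.J}
    {K₀ : C5.OpenCompactSubgroup ↥(finAdelic (↥(maximalRealSubfield L)) L (IsCMField.complexConj L) 3 H)}
    (M : Type) [Field M] [NumberField M] [IsCMField M] {Φ : CMType M} {E : IntermediateField ℚ ℂ} [FiniteDimensional ℚ ↥E]
    {hE : ∀ x : L, τ x ∈ E} {L₀ : C5.OpenCompactSubgroup ↥(torusFinAdelic M)} {Sc : ComplexRecordSystem L H τ T hT K₀} {K : C5.SmallLevel K₀}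
    {R : AmbientReceptacle M Φ E hE L₀ Sc K} (F : LevelForm M Φ E hE L₀ Sc K R) :
    IsReduced ((Motives.baseChange ↥E ℂ).obj F.N).left ∧ LocallyOfFiniteType ((Motives.baseChange ↥E ℂ).obj F.N).hom ∧
      IsSeparated F.N.hom := by
  let Y : SchemeOver ℂ := (complexSystemExt M Sc L₀).obj K
  haveI : SmoothOfRelativeDimension 2 Y.hom :=
    smoothOfRelativeDimension_of_isColimit_cofan (coproductIsCoproduct fun _ : classGroup M L₀ => Sc.Mc.obj K)
      fun _ => Sc.smooth K
  haveI : Smooth Y.hom := SmoothOfRelativeDimension.smooth 2 _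
  haveI : IsReduced Y.left := isReduced_of_smooth_over_field Y.hom
  haveI : Finite (classGroup M L₀) := Aux.finite_classGroup_printed_holds M L₀
  have hYproj : IsProjectiveOver Y :=
    isProjectiveOver_of_isColimit_cofan (coproductIsCoproduct fun _ : classGroup M L₀ => Sc.Mc.obj K) fun _ => Sc.projective K
  refine ⟨isReduced_of_isOpenImmersion F.e.hom.left, ?_, ?_⟩
  · rw [← Over.w F.e.hom]
    infer_instance
  · exact ((IsProjectiveOver.baseChange_iff F.N ℂ).1 (IsProjectiveOver.of_isoOver F.e hYproj)).isProper.toIsSeparated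

/-- **S3b-1 PROVED modulo (T1)** — `TransitionDescends` from (T1) + (G2): the complex transition map read between the level forms commutes with
`Aut(ℂ/E)` on the special pairs `e_K⁻¹([x₀, a], p)` (dense by (G2) and the homeomorphism `e_K⁻¹`), by (62) at `K` and at `K'` with the same
`s, d, t, x₀` and ★ `Aux.map_complexSystemExt_map_summandPointExt`.  [cite: Milne2005ShimuraVarieties, Thm. 13.7 (b) p. 120]
[cite: Deligne1971TravauxShimura, Variante 5.9 p. 157] -/
theorem transitionDescends_of_leaves (hT1 : LeafT1) (hG2 : LeafG2) : TransitionDescends := by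
  intro L _ _ _ H τ T hT hpos hanis K₀ htf Sc M _ _ _ j Φ hΦ E _ hE hΦE L₀ K K' f R R' F F' hP hP'
  haveI : NumberField ↥E := NumberField.mk
  letI : Algebra L ↥E := (toFieldOfMem τ E hE).toAlgebra
  obtain ⟨hred, hlft, -⟩ := levelForm_instances M F
  obtain ⟨-, -, hsep⟩ := levelForm_instances M F'
  haveI := hred; haveI := hlft; haveI := hsep
  have hK : Cardinal.mk ↥E ≤ Cardinal.aleph0 := by
    refine (Algebra.IsAlgebraic.cardinalMk_le_max ℚ ↥E).trans ?_
    rw [Cardinal.mkRat, max_self]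
  -- the line point and the dense special set, read in `N_K ⊗ ℂ` through `e_K⁻¹`
  have hH : ∀ i j, cmConjRingHom L (H i j) = H j i := cmConjRingHom_apply_eq_of_formCongr_eq_J L H τ T hT
  obtain ⟨v₃, hv⟩ := exists_mem_negCone_embedding hT
  obtain ⟨x₀, hx₀, -⟩ := exists_unique_isLinePoint L H τ T hT v₃ hv
  have hv' : ShimuraVarieties.hermForm (cmConjRingHom L) H v₃ v₃ ≠ 0 := hermForm_self_ne_zero_of_mem_negCone hv
  let u : classGroup M L₀ × finAdelic (↥(maximalRealSubfield L)) L (IsCMField.complexConj L) 3 H →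
      ComplexPoints ((Motives.baseChange ↥E ℂ).obj F.N) :=
    fun pa => AlgPoints.map F.e.inv (summandPointExt M Sc L₀ K pa.1 x₀ pa.2)
  have hsurj : Function.Surjective (AlgPoints.map (L := ℂ) F.e.inv :
      ComplexPoints ((complexSystemExt M Sc L₀).obj K) → ComplexPoints ((Motives.baseChange ↥E ℂ).obj F.N)) := by
    intro Q
    refine ⟨AlgPoints.map F.e.hom Q, ?_⟩
    rw [← AlgPoints.map_comp_apply, Iso.hom_inv_id, AlgPoints.map_id_apply]
  have hu : DenseRange u :=
    hsurj.denseRange.comp (hG2 L H τ T hT K₀ M Sc L₀ K x₀) (AlgPoints.continuous_map F.e.inv)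
  have hcomp : ∀ Q : ComplexPoints ((complexSystemExt M Sc L₀).obj K),
      AlgPoints.map (F.e.hom ≫ (complexSystemExt M Sc L₀).map f ≫ F'.e.inv) (AlgPoints.map F.e.inv Q) =
        AlgPoints.map F'.e.inv (AlgPoints.map ((complexSystemExt M Sc L₀).map f) Q) := by
    intro Q
    rw [← AlgPoints.map_comp_apply, ← AlgPoints.map_comp_apply, Iso.inv_hom_id_assoc, AlgPoints.map_comp_apply]
  obtain ⟨m, hm, -⟩ := hT1 (↥E) hK F.N F'.N (F.e.hom ≫ (complexSystemExt M Sc L₀).map f ≫ F'.e.inv) (Set.range u) hu (by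
    rintro σ _ ⟨⟨p, a⟩, rfl⟩
    obtain ⟨s, hs⟩ :=
      HeckeQuotientExt.exists_finiteIdele_isArtinCorrespondent_of_forall_mem τ E hE σ.toRingEquiv fun y => σ.commutes y
    obtain ⟨d, hd⟩ := exists_isDiagTwist_recipFactor H v₃ hH hv' (finiteIdeleRelNorm L ↥E s)
    let t : ↥(torusFinAdelic M) :=
      ⟨reflexNormFiniteIdele M Φ E s, reflexNormFiniteIdele_mem_torusFinAdelic_of_le M Φ E hΦE s⟩
    have hK₁ := hP σ s hs v₃ x₀ hx₀ d hd t rfl a p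
    have hK₂ := hP' σ s hs v₃ x₀ hx₀ d hd t rfl a p
    change AlgPoints.map _ (pointsOfForm F.N (σ • (pointsOfForm F.N).symm (AlgPoints.map F.e.inv (summandPointExt M Sc L₀ K p x₀ a)))) =
      pointsOfForm F'.N (σ • (pointsOfForm F'.N).symm
        (AlgPoints.map (F.e.hom ≫ (complexSystemExt M Sc L₀).map f ≫ F'.e.inv) (AlgPoints.map F.e.inv (summandPointExt M Sc L₀ K p x₀ a))))
    rw [hK₁, Equiv.apply_symm_apply, hcomp, hcomp, map_complexSystemExt_map_summandPointExt, map_complexSystemExt_map_summandPointExt,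
      hK₂, Equiv.apply_symm_apply])
  exact ⟨m, hm⟩

/-- **S3b-2 PROVED modulo (T1)** — `TranslationDescends`, the same move with ★ `Aux.map_translMorExt_summandPointExt`; the class group being
commutative, `c · (t · p) = t · (c · p)`.  [cite: Milne2005ShimuraVarieties, Thm. 13.7 (b) p. 120; (33) p. 58] -/
theorem translationDescends_of_leaves (hT1 : LeafT1) (hG2 : LeafG2) : TranslationDescends := by
  intro L _ _ _ H τ T hT hpos hanis K₀ htf Sc M _ _ _ j Φ hΦ E _ hE hΦE L₀ K R F hP c
  haveI : NumberField ↥E := NumberField.mk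
  letI : Algebra L ↥E := (toFieldOfMem τ E hE).toAlgebra
  obtain ⟨hred, hlft, hsep⟩ := levelForm_instances M F
  haveI := hred; haveI := hlft; haveI := hsep
  have hK : Cardinal.mk ↥E ≤ Cardinal.aleph0 := by
    refine (Algebra.IsAlgebraic.cardinalMk_le_max ℚ ↥E).trans ?_
    rw [Cardinal.mkRat, max_self]
  have hH : ∀ i j, cmConjRingHom L (H i j) = H j i := cmConjRingHom_apply_eq_of_formCongr_eq_J L H τ T hT
  obtain ⟨v₃, hv⟩ := exists_mem_negCone_embedding hT
  obtain ⟨x₀, hx₀, -⟩ := exists_unique_isLinePoint L H τ T hT v₃ hv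
  have hv' : ShimuraVarieties.hermForm (cmConjRingHom L) H v₃ v₃ ≠ 0 := hermForm_self_ne_zero_of_mem_negCone hv
  let u : classGroup M L₀ × finAdelic (↥(maximalRealSubfield L)) L (IsCMField.complexConj L) 3 H →
      ComplexPoints ((Motives.baseChange ↥E ℂ).obj F.N) :=
    fun pa => AlgPoints.map F.e.inv (summandPointExt M Sc L₀ K pa.1 x₀ pa.2)
  have hsurj : Function.Surjective (AlgPoints.map (L := ℂ) F.e.inv :
      ComplexPoints ((complexSystemExt M Sc L₀).obj K) → ComplexPoints ((Motives.baseChange ↥E ℂ).obj F.N)) := by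
    intro Q
    refine ⟨AlgPoints.map F.e.hom Q, ?_⟩
    rw [← AlgPoints.map_comp_apply, Iso.hom_inv_id, AlgPoints.map_id_apply]
  have hu : DenseRange u :=
    hsurj.denseRange.comp (hG2 L H τ T hT K₀ M Sc L₀ K x₀) (AlgPoints.continuous_map F.e.inv)
  have hcomp : ∀ Q : ComplexPoints ((complexSystemExt M Sc L₀).obj K),
      AlgPoints.map (F.e.hom ≫ translMorExt M Sc L₀ K c ≫ F.e.inv) (AlgPoints.map F.e.inv Q) =
        AlgPoints.map F.e.inv (AlgPoints.map (translMorExt M Sc L₀ K c) Q) := by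
    intro Q
    rw [← AlgPoints.map_comp_apply, ← AlgPoints.map_comp_apply, Iso.inv_hom_id_assoc, AlgPoints.map_comp_apply]
  obtain ⟨r, hr, -⟩ := hT1 (↥E) hK F.N F.N (F.e.hom ≫ translMorExt M Sc L₀ K c ≫ F.e.inv) (Set.range u) hu (by
    rintro σ _ ⟨⟨p, a⟩, rfl⟩
    obtain ⟨s, hs⟩ :=
      HeckeQuotientExt.exists_finiteIdele_isArtinCorrespondent_of_forall_mem τ E hE σ.toRingEquiv fun y => σ.commutes y
    obtain ⟨d, hd⟩ := exists_isDiagTwist_recipFactor H v₃ hH hv' (finiteIdeleRelNorm L ↥E s)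
    let t : ↥(torusFinAdelic M) :=
      ⟨reflexNormFiniteIdele M Φ E s, reflexNormFiniteIdele_mem_torusFinAdelic_of_le M Φ E hΦE s⟩
    have hK₁ := hP σ s hs v₃ x₀ hx₀ d hd t rfl a p
    have hK₂ := hP σ s hs v₃ x₀ hx₀ d hd t rfl a (c * p)
    change AlgPoints.map _ (pointsOfForm F.N (σ • (pointsOfForm F.N).symm (AlgPoints.map F.e.inv (summandPointExt M Sc L₀ K p x₀ a)))) =
      pointsOfForm F.N (σ • (pointsOfForm F.N).symm
        (AlgPoints.map (F.e.hom ≫ translMorExt M Sc L₀ K c ≫ F.e.inv) (AlgPoints.map F.e.inv (summandPointExt M Sc L₀ K p x₀ a))))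
    rw [hK₁, Equiv.apply_symm_apply, hcomp, hcomp, map_translMorExt_summandPointExt, map_translMorExt_summandPointExt, hK₂,
      Equiv.apply_symm_apply, mul_left_comm c (classOf M L₀ t) p])
  exact ⟨r, hr⟩

/-- **THE S3 COMPOSITION (kernel-checked)** — `ClosureDescent` from the four statements, through A-p06 ★ p627312
`Motives.exists_functor_action_iso_of_levelwise'` with `G := Motives.baseChange ↥E ℂ` (faithful: Mathlib `Over.faithful_pullback`),
`F := complexSystemExt M Sc L₀`, `Γ := classGroup M L₀`, `τ := translMorExt` (★ `translMorExt_one/_mul/_comp_map`, B-typ03 p626711),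
`P K Z i := ReciprocityThrough M Φ E hE L₀ Sc K Z i.inv` — whose last conjunct IS `IsCanonicalDescentAtExt M Φ E hE L₀ Sc N e` (`(e.app K).inv =
e.inv.app K`).  [cite: Deligne1971TravauxShimura, Cor. 5.7 p. 156, Variante 5.9 p. 157] [cite: Milne2005ShimuraVarieties, Thm. 13.7 p. 120] -/
theorem closureDescent_of_leaves (h₁ : LevelFormExists) (h₂ : PointAction) (h₃ : TransitionDescends) (h₄ : TranslationDescends) :
    ClosureDescent := by
  intro L _ _ _ H τ T hT hpos hanis K₀ htf Sc M _ _ _ j Φ hΦ E _ hE hΦE L₀ hR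
  choose R hR using hR
  have F : ∀ K : C5.SmallLevel K₀, LevelForm M Φ E hE L₀ Sc K (R K) := fun K =>
    Classical.choice (h₁ L H τ T hT hpos hanis K₀ htf Sc M j Φ hΦ E hE hΦE L₀ K (R K) (hR K))
  have hP : ∀ K : C5.SmallLevel K₀, ReciprocityThrough M Φ E hE L₀ Sc K (F K).N (F K).e.inv := fun K =>
    h₂ L H τ T hT hpos hanis K₀ htf Sc M j Φ hΦ E hE hΦE L₀ K (R K) (F K)
  haveI : (Motives.baseChange ↥E ℂ).Faithful := Over.faithful_pullback _
  obtain ⟨N, ρ, e, hnat, hcompat, hrec⟩ :=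
    exists_functor_action_iso_of_levelwise' (Motives.baseChange ↥E ℂ) (complexSystemExt M Sc L₀) (fun K => (F K).N)
      (fun K => (F K).e) (Γ := classGroup M L₀) (fun K c => translMorExt M Sc L₀ K c) (fun K => translMorExt_one M Sc L₀ K)
      (fun K c c' => translMorExt_mul M Sc L₀ K c c') (fun f c => translMorExt_comp_map M Sc L₀ f c)
      (fun K Z i => ReciprocityThrough M Φ E hE L₀ Sc K Z i.inv) hP
      (fun {K K'} f => h₃ L H τ T hT hpos hanis K₀ htf Sc M j Φ hΦ E hE hΦE L₀ K K' f (R K) (R K') (F K) (F K') (hP K) (hP K'))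
      (fun K c => h₄ L H τ T hT hpos hanis K₀ htf Sc M j Φ hΦ E hE hΦE L₀ K (R K) (F K) (hP K) c)
  exact ⟨N, ρ, e, hnat, hcompat, hrec⟩


end S3SecondLayer

/-! ### §4. S5 and S3 ARE THEOREMS; the head `canonicalModel_exists_ext_of` (the open statement `AmbientReceptacleExists` is the registered line's business) -/

/-- **S3 — `ClosureDescent` IS A THEOREM** (v1/v2: a `sorry`; v3: [Deligne 1971] Cor. 5.7 / Variante 5.9 run in §3b as `closureDescent_of_leaves`
over the four S3 statements, themselves PROVED from the ★ leaves (O1) p625501, (T1) p627060, (T2) p626711, (G2) p625412, (G1) p625425, (Z1) p624611 and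
assembled by (ASM) p627312).  No `sorry` below it; kept under its v1 name so the head is unchanged.
[cite: Deligne1971TravauxShimura, Cor. 5.7 p. 156, Variante 5.9 p. 157] [cite: Milne2005ShimuraVarieties, Thm. 13.7 p. 120] -/
theorem closureDescent_holds : ClosureDescent :=
  closureDescent_of_leaves (levelFormExists_of_leaves leafZ1_holds leafG1_holds) pointAction_holds (transitionDescends_of_leaves leafT1_holds leafG2_holds)
    (translationDescends_of_leaves leafT1_holds leafG2_holds)

/-- **HEAD — I-1′ from the three stubs** (real proof: pick a receptacle at each level, feed stability, descend).  Concludes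
`Literature.AlgebraicGeometry.ShimuraVarieties.UnitaryCanonicalModel.Aux.canonicalModel_exists_ext_printed` BY NAME; with `stub_F1ext := ` this
term the hDel workfile `B1HeckeQuotientDescent.lean` becomes sorry-free the day the three stubs are theorems.
[cite: Deligne1979ShimuraVarieties, Criterion 2.3.1 (PDF p. 29)] [cite: Deligne1971TravauxShimura, Cor. 5.7 p. 156] -/
theorem canonicalModel_exists_ext_of (h₁ : AmbientReceptacleExists) (h₅ : ImageStableOfReciprocity) (h₃ : ClosureDescent) :
    Aux.canonicalModel_exists_ext_printed := by
  intro L _ _ _ H τ T hT hpos hanis K₀ htf Sc M _ _ _ j Φ hΦ E _ hE hΦE L₀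
  refine h₃ L H τ T hT hpos hanis K₀ htf Sc M j Φ hΦ E hE hΦE L₀ ?_
  intro K
  obtain ⟨R⟩ := h₁ L H τ T hT hpos hanis K₀ htf Sc M j Φ hΦ E hE hΦE L₀ K
  exact ⟨R, h₅ L H τ T hT hpos hanis K₀ htf Sc M j Φ hΦ E hE hΦE L₀ K R⟩


/-! ### §5. AUDIT (kernel-checked, no `sorry`): the posited interface is CONSISTENT with the leaf — I-1′'s own `E`-form
`(N.obj K, e.inv.app K)` instantiates an `AmbientReceptacle` at every level (so `ReciprocityThrough` is `IsCanonicalDescentAtExt` at level `K`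
definitionally, and the interface is not over-constrained); together with the head this records the costume check of the module docstring:
`I-1′ ⟹ AmbientReceptacleExists` here, `stubs ⟹ I-1′` by `canonicalModel_exists_ext_of`. -/
example (hI : Aux.canonicalModel_exists_ext_printed) : AmbientReceptacleExists := by
  intro L _ _ _ H τ T hT hpos hanis K₀ htf Sc M _ _ _ j Φ hΦ E _ hE hΦE L₀ K
  obtain ⟨N, ρ, e, hnat, hcompat, hrec⟩ := hI L H τ T hT hpos hanis K₀ htf Sc M j Φ hΦ E hE hΦE L₀
  refine ⟨{ A := N.obj K, ι := e.inv.app K, isClosedImmersion := ?_,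
            reciprocity := fun σ s hs v₃ x hx d hd t ht a p => hrec K σ s hs v₃ x hx d hd t ht a p }⟩
  have hleft : IsIso (e.inv.app K).left := by infer_instance
  have hci : IsClosedImmersion (e.inv.app K).left := by infer_instance
  exact hci

/-! ### §7. `HDel` ⟸ `AmbientReceptacleExists`

With S5 (§3, file 2/4) and S3 (§3b) theorems, the crux `HDel` (stmt-HodgeConjecture-24835; `HDel` := `HypDel` := `canonicalModel_exists_printed`)
follows from the ONE open statement `AmbientReceptacleExists` through the head `canonicalModel_exists_ext_of` and fan A's landed closing theorem
★ p610565 `Summit.HodgeConjecture.CorCM.HypDel.HDel_of_ext'` (I-1′ ⟹ HDel, I-6 discharged by ★ p616273 `descentToIntersection_printed_holds`).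
HONEST LABEL (ref2 N2, v1c): given §3/§3b/§5, `AmbientReceptacleExists` is EQUIVALENT to I-1′ in kernel (I-1′ ⟹ it by §5; it ⟹ I-1′ by §4) — it
RE-LABELS hDel's one open leaf as «the levelwise Siegel-type receptacle with (62) at the special pairs» (S1+S2+S4), it does not reduce it.
HC_CM is proved only modulo the 7 printed citations until rung 0 closes. [cite: Deligne1979ShimuraVarieties, 2.2.5, 2.3.1, 2.3.10 and Cor. 2.7.21] [cite: Deligne1971TravauxShimura, Cor. 5.7 p. 156, Prop. 5.10 p. 157] -/

/-- **`HDel` from a levelwise receptacle** (S1+S2+S4 ⟹ hDel: head §4 + S5 §3 + S3 §3b + ★ `HDel_of_ext'`). [cite: Deligne1979ShimuraVarieties, 2.3.1, 2.2.5] -/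
theorem HDel_of_receptacle (h₁ : AmbientReceptacleExists) : Summit.HodgeConjecture.HodgeConjecture.Theses.HCCMUnconditional.HDel :=
  Summit.HodgeConjecture.CorCM.HypDel.HDel_of_ext' (canonicalModel_exists_ext_of h₁ imageStableOfReciprocity_holds closureDescent_holds)

end Summit.HodgeConjecture.CorCM.HypDel.ExtReceptacle
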